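import Summits.BirchSwinnertonDyer.BirchSwinnertonDyer.Theorems.ByReductionTypeAtTwoSupersingularHondaSystemAtTwoSprungPrimal
import Mathlib.Tactic.Module
import HarnessLib

/-!
# Sprung's Honda system AT `p = 2`, IX: the PRIMAL Honda data over `ℚ_[2]` WITH THE LOGARITHMS EXPORTED (FILE E0 of the ♭ explicit
# reciprocity computation at `2` — crux `SupersingularRankZeroAtTwo`, item stmt-BirchSwinnertonDyer-19097, line `odd_blind_package` v2.19,
# `stub_flatPackage` conjunct (8), F3)

Seat `bsd-2adic-tower-1` GEN 69, hand «hF3-ERL» (pen GEN 41 SUMMON 20260831T215831Z, director-bsd (979) slot 2). Sequel of VII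
(`…SprungPrimal`: `SSHondaTwo.sprungPrimal_padic`, whose `∃ cneg d` HIDES the tower points and their logarithms). HONEST FRAMING: theorems
only (no definition, no named fact, no instance, no `sorry`); a LOCAL construction at `2`; helper toward conjunct (8) F3 of `stub_flatPackage`
(it pins THE Honda system whose pairing sums FILEs E1–E3 evaluate); closes no stub and no item; 19097 OPEN; BSD₂ is proved for no
supersingular curve and BSD for no curve by any of this.

## What

★ `sprungPrimal_padic_withLog` — for every globally minimal `W/ℚ` with `GoodSS W 2` (`a = a₂(W) ∈ {0, ±2}`), the cyclotomic `κ` and every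
`ι`, there are: Sprung's sequence `x : ℕ → ℚ₂` (`x 0 = 1`, `2x_1 = a`, `2x_{k+2} = a x_{k+1} − x_k`), tower points `y_m ∈ E(ℚ₂(ζ_{2^m}))` ON THE
`2`-ADIC MODEL with the three DISPLAY clauses of K3's `PlusLayer.plusHondaSystemTwo_padic_withLog` (`T⁻¹ y_m ∈ L(m)`-points, `∈ E₁`, and
**`Λ(T⁻¹ y_m) = ℓ_m(x) := ∑_{k<m} x_k (ζ_{2^{m−k}} − 1)`** — Sprung's logarithm in place of Kobayashi's `ell 2 m`), the stabiliser clause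
`τ ∈ Stab(ζ_{2^m}) ⇒ τ•y_m = y_m`, inverters `σ_m ζ_{2^m} = ζ_{2^m}⁻¹`, the integer `N = #Ẽ(𝔽₂) = 3 − a` (ODD), and the PRIMAL Honda data
`cneg = −y_1`, `d_n = N•(y_{n+2} + σ_{n+2}•y_{n+2}) − 2•y_1` with EXACTLY the package of `sprungPrimal_padic` (levels, `c_0 = (a²−2a−1)•cneg`,
`Tr_{1/0} c_1 = a•c_0 + (4−2a)•cneg`, `Tr_{n+1/n} c_{n+1} = a•c_n − c_{n−1}`, (GEN) with multiplier `2`, (NONDIV)). The proof is VII's, with the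
witnesses named in the conclusion instead of hidden.

References: [Sprung2012] F. Sprung, J. Number Theory 132 (2012), Thm. 2.2 (pp. 1486–1487), Lemma 2.3; [Kobayashi2003] S. Kobayashi, Invent.
Math. 152 (2003), §8.4 (Lemma 8.9), Props. 8.11–8.12, 8.26; [Honda1970] Thm. 2, Thm. 9; [KuriharaOtsuki2006] p. 557; [Washington1997] §13.1.
-/

set_option autoImplicit false
-- the Theorems namespace of this sub repeats the summit name by design (D-0017 nested layout)
set_option linter.dupNamespace false

noncomputable section

open scoped Classical IntermediateField Topology NNReal NumberField
open Filter PowerSeries Finset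

namespace Summit.BirchSwinnertonDyer.BirchSwinnertonDyer.Theorems.SSHondaTwo

open Field WeierstrassCurve NumberField IsDedekindDomain Literature.NumberTheory.EllipticCurves
  Literature.NumberTheory.GaloisRepresentations Literature.RingTheory.FormalGroups
  Literature.NumberTheory.EllipticCurves.ZpExtension Literature.NumberTheory.EllipticCurves.Kobayashi2003
  Literature.NumberTheory.EllipticCurves.FormalGroupChart Literature.NumberTheory.EllipticCurves.Rank1Residual
  Summit.BirchSwinnertonDyer.Rank1Residual.Additive Summit.BirchSwinnertonDyer.Rank1Residual.Additive.PadicCyclotomicTower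
  Summit.BirchSwinnertonDyer.Rank1Residual.Additive.BallEval Summit.BirchSwinnertonDyer.Rank1Residual.Additive.HondaFss
  Summit.BirchSwinnertonDyer.Rank1Residual.Additive.LocalTransport
  Summit.BirchSwinnertonDyer.BirchSwinnertonDyer.Theorems.SignedKatoOffTwo.LocalAllPrimes
  Summit.BirchSwinnertonDyer.BirchSwinnertonDyer.Theorems.SignedKatoOffTwo.LocalTwo
  Summit.BirchSwinnertonDyer.BirchSwinnertonDyer.Theorems.SignedEC
  Summit.BirchSwinnertonDyer.BirchSwinnertonDyer.Theorems.SignedEC.PlusLayer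
  Summit.BirchSwinnertonDyer.BirchSwinnertonDyer.Theorems.SignedEC.PlusTower

/-! ## The primal Honda data at `2` over `ℚ_[2]`, with Sprung's sequence, the tower points and their logarithms exported -/

/-- **PRIMAL Honda data at `2` over `ℚ_[2]` WITH LOGS** (every `ι`, EVERY `W` with `GoodSS W 2`, `a = a₂(W)`): Sprung's sequence `x`, the
tower points `y_m` on the `2`-adic model with `Λ(T⁻¹ y_m) = ∑_{k<m} x_k(ζ_{2^{m−k}} − 1)`, their stabilisers, inverters `σ_m`, the odd integer
`N = 3 − a`, and the primal Honda system `cneg = −y_1`, `d_n = N•(y_{n+2} + σ_{n+2}•y_{n+2}) − 2•y_1` with the package of `sprungPrimal_padic`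
(levels, the three trace relations with the typed constants, (GEN), (NONDIV)). [cite: Sprung2012, Thm. 2.2 (pp. 1486–1487), Lemma 2.3]
[cite: Kobayashi2003, Lemma 8.9, Props. 8.11–8.12] [cite: KuriharaOtsuki2006, p. 557] -/
theorem sprungPrimal_padic_withLog (W : WeierstrassCurve ℚ) [W.IsElliptic] [W.IsGloballyMinimal]
    (hss : GoodSS W 2) (κ : ZpExtension ℚ 2) (hκ : κ.IsCyclotomic) (ι : AlgebraicClosure ℚ →ₐ[ℚ] AlgebraicClosure ℚ_[2]) :
    ∃ (x : ℕ → ℚ_[2]) (y : ℕ → localPoints W ℚ_[2]) (σ : ℕ → absoluteGaloisGroup ℚ_[2]) (N : ℕ)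
      (cneg : localPoints W ℚ_[2]) (d : ℕ → localPoints W ℚ_[2]),
      (x 0 = 1 ∧ (2 : ℚ_[2]) * x 1 = W.frobeniusTrace 2 ∧ ∀ k, (2 : ℚ_[2]) * x (k + 2) = W.frobeniusTrace 2 * x (k + 1) - x k) ∧
      (haveI := isIntegral_genFib_baseChange 2 ((integralModelInt W).map (Int.castRingHom ℤ_[2]))
        ∀ m, (toLoc ((genFibΩ_eq_baseChange ((integralModelInt W).map (Int.castRingHom ℤ_[2]))).trans
              (baseChange_twoAdicModel W))).symm (y m) ∈
            subfieldPoints (genFibΩ 2 ((integralModelInt W).map (Int.castRingHom ℤ_[2]))) (layer 2 m).toSubfield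
              coeffs_mem_layer ∧
          (toLoc ((genFibΩ_eq_baseChange ((integralModelInt W).map (Int.castRingHom ℤ_[2]))).trans
              (baseChange_twoAdicModel W))).symm (y m) ∈
            kernel (Valued.v (R := PadicAlgCl 2)) (genFibΩ 2 ((integralModelInt W).map (Int.castRingHom ℤ_[2]))) ∧
          ptLogΩ 2 ((integralModelInt W).map (Int.castRingHom ℤ_[2]))
            ((toLoc ((genFibΩ_eq_baseChange ((integralModelInt W).map (Int.castRingHom ℤ_[2]))).trans
              (baseChange_twoAdicModel W))).symm (y m)) =
            ∑ k ∈ range m, algebraMap ℚ_[2] (PadicAlgCl 2) (x k) * (zeta 2 (m - k) - 1)) ∧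
      (∀ m, ∀ τ ∈ stab 2 m, τ • y m = y m) ∧
      (∀ m, 1 ≤ m → σ m • zeta 2 m = (zeta 2 m)⁻¹) ∧
      ((N : ℤ) = 3 - W.frobeniusTrace 2 ∧ Odd N) ∧
      cneg = -y 1 ∧
      (∀ n, d n = N • (y (n + 2) + σ (n + 2) • y (n + 2)) - 2 • y 1) ∧
      cneg ∈ localLayerPointsOfEmb κ ι W 0 ∧ (∀ m, d m ∈ localLayerPointsOfEmb κ ι W m) ∧
      d 0 = (W.frobeniusTrace 2 ^ 2 - 2 * W.frobeniusTrace 2 - 1) • cneg ∧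
      localTraceOfEmb κ ι W 0 1 (d 1) = W.frobeniusTrace 2 • d 0 + (4 - 2 * W.frobeniusTrace 2) • cneg ∧
      (∀ n : ℕ, 1 ≤ n → localTraceOfEmb κ ι W n (n + 1) (d (n + 1)) = W.frobeniusTrace 2 • d n - d (n - 1)) ∧
      (∀ m : ℕ, 1 ≤ m → ∀ P ∈ localLayerPointsOfEmb κ ι W m,
        ∃ B ∈ AddSubgroup.closure (Set.range fun σ : absoluteGaloisGroup ℚ_[2] ↦ σ • d m),
          ∃ P' ∈ localLayerPointsOfEmb κ ι W (m - 1), ∃ R ∈ localLayerPointsOfEmb κ ι W m, P = B + P' + 2 • R) ∧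
      (∀ b ∈ localLayerPointsOfEmb κ ι W 0, cneg ≠ 2 • b) := by
  haveI hFt : ∀ m, Fintype (stab 2 m ⧸ (stab 2 (m + 1)).subgroupOf (stab 2 m)) := fun m =>
    haveI := finite_stab_quot m; Fintype.ofFinite _
  set a : ℤ := W.frobeniusTrace 2 with ha_def
  have ha2 : (2 : ℤ) ∣ a := hss.2
  -- the `2`-adic model and its identification with `W ⊗ ℚ̄₂`
  set M : WeierstrassCurve ℤ_[2] := (integralModelInt W).map (Int.castRingHom ℤ_[2]) with hM
  haveI := isElliptic_coe_twoAdicModel W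
  haveI := isElliptic_toZMod_twoAdicModel W hss.1
  haveI hintΩ := isIntegral_genFib_baseChange 2 M
  set hV := (genFibΩ_eq_baseChange M).trans (baseChange_twoAdicModel W) with hVdef
  have htr : Literature.NumberTheory.EllipticCurves.HasseManin.tr (M.map PadicInt.toZMod) = a := by
    rw [hM, tr_twoAdicModel W hss.1]
  have h₁ := a₁_twoAdicModel_mem W hss
  -- the Sprung sequence `x 0 = 1`, `2 x 1 = a`, `2 x (k+2) = a x (k+1) − x k`
  let xs : ℕ → ℚ_[2] × ℚ_[2] := fun k ↦
    Nat.rec ((1 : ℚ_[2]), ((a : ℚ_[2]) / 2)) (fun _ q ↦ (q.2, ((a : ℚ_[2]) * q.2 - q.1) / 2)) k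
  let x : ℕ → ℚ_[2] := fun k ↦ (xs k).1
  have hx0 : x 0 = 1 := rfl
  have hx1 : ((2 : ℕ) : ℚ_[2]) * x 1 = a := by
    show ((2 : ℕ) : ℚ_[2]) * ((a : ℚ_[2]) / 2) = a
    push_cast; field_simp
  have hrec : ∀ k, ((2 : ℕ) : ℚ_[2]) * x (k + 2) = a * x (k + 1) - x k := by
    intro k
    show ((2 : ℕ) : ℚ_[2]) * (((a : ℚ_[2]) * (xs k).2 - (xs k).1) / 2) = a * (xs k).2 - (xs k).1
    push_cast; field_simp
  have ha : ‖((a : ℤ) : ℚ_[2])‖ ≤ ((2 : ℕ) : ℝ)⁻¹ := SprungHonda.norm_intCast_le_inv_of_dvd (p := 2) (by exact_mod_cast ha2)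
  have hxb : ∀ k, ‖x k‖ ≤ Real.sqrt (2 : ℕ) ^ k := SprungHonda.norm_sprungSeq_le ha hx0 hx1 hrec
  -- the logarithm of `F_ss` and the integral Honda isomorphism (file IV, every prime)
  have htr' : (Literature.NumberTheory.EllipticCurves.HasseManin.tr (M.map PadicInt.toZMod) : ℚ_[2]) = (a : ℚ_[2]) := by
    rw [htr]
  have hℓ : ∀ n, ‖coeff n (hondaShift 2 (Literature.NumberTheory.EllipticCurves.HasseManin.tr (M.map PadicInt.toZMod) : ℚ_[2])
      (PowerSeries.mk fun d ↦ ∑' k : ℕ, x k * ((((2 : ℕ) ^ k).choose d : ℚ_[2]) - if d = 0 then 1 else 0)))‖ ≤ 1 := fun n ↦ by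
    rw [htr']; exact SprungHonda.norm_coeff_hondaShift_sprungLog_le_one ha hx0 hx1 hrec n
  obtain ⟨i, j, hi0, hj0, hij, -, hlog⟩ :=
    exists_integral_hondaIso' M (SprungHonda.constantCoeff_sprungLog x) (SprungHonda.norm_coeff_one_sprungLog hx0 hxb) hℓ
  -- the tower points over `ℚ₂(ζ_{2^m})`
  obtain ⟨c, hc0, hcL, hck, hcΛ⟩ := SprungHonda.exists_sprungTowerPoints (M := M) hxb hi0 hlog
  -- inverters
  have hσex : ∀ m : ℕ, ∃ σ : absoluteGaloisGroup ℚ_[2], σ • zeta 2 (m + 1) = (zeta 2 (m + 1))⁻¹ :=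
    fun m ↦ exists_smul_zeta_eq_inv 2 (by omega)
  choose σ₀ hσ₀ using hσex
  set σ : ℕ → absoluteGaloisGroup ℚ_[2] := fun m ↦ σ₀ (m - 1) with hσ_def
  have hσ : ∀ m, 1 ≤ m → σ m • zeta 2 m = (zeta 2 m)⁻¹ := fun m hm ↦ by
    obtain ⟨k, rfl⟩ := Nat.exists_eq_add_of_le' hm
    simp only [hσ_def, Nat.add_sub_cancel]
    exact hσ₀ k
  -- `N₁ = #Ẽ(𝔽₂) = 3 − a`, odd
  set N₁ : ℕ := Nat.card (M.map PadicInt.toZMod).toAffine.Point with hN₁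
  have hN₁a : (N₁ : ℤ) = 3 - a := by
    have h := htr
    rw [Literature.NumberTheory.EllipticCurves.HasseManin.tr, ZMod.card] at h
    push_cast at h
    linarith
  have hN₁odd : Odd N₁ := by
    obtain ⟨b, hb⟩ := ha2
    refine Nat.odd_iff.mpr ?_
    omega
  have hN₁s : ∀ X : localPoints W ℚ_[2], N₁ • X = (3 - a) • X := fun X ↦ by rw [← natCast_zsmul, hN₁a]
  -- the points: `y_m = toLoc (c m)`, `e_n = y_{n+2} + σ_{n+2}•y_{n+2}`, `cneg = −y_1`, `d_n = N₁•e_n − 2•y_1`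
  have hy1fix : ∀ τ : absoluteGaloisGroup ℚ_[2], τ • toLoc hV (c 1) = toLoc hV (c 1) :=
    smul_toLoc_one_eq_of_mem_layer hV hcL
  have hy1L0 : toLoc hV (c 1) ∈ localLayerPointsOfEmb κ ι W 0 := (mem_localLayerPointsOfEmb_zero_iff κ ι W _).mpr hy1fix
  have heL : ∀ n, toLoc hV (c (n + 2)) + σ (n + 2) • toLoc hV (c (n + 2)) ∈ localLayerPointsOfEmb κ ι W n := fun n ↦
    add_smul_mem_localLayerPointsOfEmb_two_stab W ι hκ (hσ (n + 2) (by omega))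
      (fun τ hτ ↦ smul_toLoc_eq_of_mem_layer hV hcL (n + 2) hτ)
  have hL : ∀ n, N₁ • (toLoc hV (c (n + 2)) + σ (n + 2) • toLoc hV (c (n + 2))) - 2 • toLoc hV (c 1) ∈
      localLayerPointsOfEmb κ ι W n := fun n ↦
    sub_mem (AddSubgroup.nsmul_mem _ (heL n) N₁)
      (AddSubgroup.nsmul_mem _ (localLayerPointsOfEmb_mono κ ι W (Nat.zero_le n) hy1L0) 2)
  refine ⟨x, fun m ↦ toLoc hV (c m), σ, N₁, -toLoc hV (c 1),
    fun n ↦ N₁ • (toLoc hV (c (n + 2)) + σ (n + 2) • toLoc hV (c (n + 2))) - 2 • toLoc hV (c 1),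
    ⟨hx0, by exact_mod_cast hx1, fun k ↦ by exact_mod_cast hrec k⟩, fun m ↦ ?_, fun m τ hτ ↦ smul_toLoc_eq_of_mem_layer hV hcL m hτ, hσ,
    ⟨hN₁a, hN₁odd⟩, rfl, fun n ↦ rfl, neg_mem hy1L0, hL, ?_, ?_, ?_, ?_, ?_⟩
  · -- the display clauses of `y_m = toLoc hV (c m)`
    simp only [AddEquiv.symm_apply_apply]
    exact ⟨hcL m, hck m, hcΛ m⟩
  · -- `c_0 = (a² − 2a − 1) • cneg`
    show N₁ • (toLoc hV (c 2) + σ 2 • toLoc hV (c 2)) - 2 • toLoc hV (c 1) = _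
    rw [sprungPlus_zero hV h₁ hx0 hx1 hrec hc0 hcL hck hcΛ (hσ 2 (by omega)), hN₁s]
    module
  · -- `Tr_{1/0} c_1 = a • c_0 + (4 − 2a) • cneg`
    have hy1s : ∀ τ ∈ stab 2 2, τ • toLoc hV (c 1) = toLoc hV (c 1) := fun τ _ ↦ hy1fix τ
    have key : ∑ q : stab 2 2 ⧸ (stab 2 (2 + 1)).subgroupOf (stab 2 2),
        ((q.out : stab 2 2) : absoluteGaloisGroup ℚ_[2]) •
          (N₁ • (toLoc hV (c 3) + σ 3 • toLoc hV (c 3)) - 2 • toLoc hV (c 1)) =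
        a • (N₁ • (toLoc hV (c 2) + σ 2 • toLoc hV (c 2)) - 2 • toLoc hV (c 1)) + (4 - 2 * a) • -toLoc hV (c 1) := by
      simp_rw [smul_sub, smul_comm _ N₁, smul_comm _ (2 : ℕ)]
      rw [Finset.sum_sub_distrib, ← Finset.smul_sum, ← Finset.smul_sum,
        sprungPlus_trace_one hV h₁ hx0 hx1 hrec hcL hck hcΛ hσ, sum_out_smul_eq_two_nsmul (by omega) hy1s]
      simp only [hN₁s]
      generalize toLoc hV (c 2) + σ 2 • toLoc hV (c 2) = E₀
      module
    rw [localTraceOfEmb_two_eq_sum_stab ι W hκ (by omega : 0 ≤ 1) (hL 1)]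
    convert key using 2
  · -- `Tr_{n+1/n} c_{n+1} = a • c_n − c_{n−1}` (`n ≥ 1`)
    intro n hn
    have hy1s : ∀ τ ∈ stab 2 (n + 2), τ • toLoc hV (c 1) = toLoc hV (c 1) := fun τ _ ↦ hy1fix τ
    have hidx : n - 1 + 2 = n + 1 := by omega
    have key : ∑ q : stab 2 (n + 2) ⧸ (stab 2 (n + 2 + 1)).subgroupOf (stab 2 (n + 2)),
        ((q.out : stab 2 (n + 2)) : absoluteGaloisGroup ℚ_[2]) •
          (N₁ • (toLoc hV (c (n + 3)) + σ (n + 3) • toLoc hV (c (n + 3))) - 2 • toLoc hV (c 1)) =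
        a • (N₁ • (toLoc hV (c (n + 2)) + σ (n + 2) • toLoc hV (c (n + 2))) - 2 • toLoc hV (c 1)) -
          (N₁ • (toLoc hV (c (n + 1)) + σ (n + 1) • toLoc hV (c (n + 1))) - 2 • toLoc hV (c 1)) := by
      simp_rw [smul_sub, smul_comm _ N₁, smul_comm _ (2 : ℕ)]
      rw [Finset.sum_sub_distrib, ← Finset.smul_sum, ← Finset.smul_sum,
        sprungPlus_trace_succ hV h₁ hx0 hx1 hrec hcL hck hcΛ hσ hn, sum_out_smul_eq_two_nsmul (by omega) hy1s]
      simp only [hN₁s]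
      generalize toLoc hV (c (n + 2)) + σ (n + 2) • toLoc hV (c (n + 2)) = E₂
      generalize toLoc hV (c (n + 1)) + σ (n + 1) • toLoc hV (c (n + 1)) = E₁
      module
    rw [localTraceOfEmb_two_eq_sum_stab ι W hκ (by omega : n ≤ n + 1) (hL (n + 1))]
    dsimp only
    rw [hidx]
    convert key using 2
  · -- (GEN) for `m ≥ 1`
    intro m hm Q hQ
    obtain ⟨m', rfl⟩ := Nat.exists_eq_add_of_le' hm
    have htors : ∀ Q ∈ subfieldPoints (genFibΩ 2 M) (layer 2 (m' + 1 + 2)).toSubfield coeffs_mem_layer,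
        ∀ k : ℕ, 2 ^ k • Q = 0 → Q = 0 :=
      fun Q hQ k hk ↦ eq_zero_of_two_pow_smul_eq_zero_of_mem_subfieldPoints_layer M h₁ _ hQ hk
    set act : absoluteGaloisGroup ℚ_[2] → (genFibΩ 2 M).toAffine.Point → (genFibΩ 2 M).toAffine.Point :=
      fun τ P ↦ (toLoc hV).symm (τ • toLoc hV P) with hact
    -- the plus point `e = c + σ c` at level `m' + 3`
    have hσ3 := hσ (m' + 3) (by omega)
    set e := c (m' + 3) + act (σ (m' + 3)) (c (m' + 3)) with he
    have hacte : act (σ (m' + 3)) (c (m' + 3)) = (toLoc hV).symm (σ (m' + 3) • toLoc hV (c (m' + 3))) := rfl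
    have he_toLoc : toLoc hV e = toLoc hV (c (m' + 3)) + σ (m' + 3) • toLoc hV (c (m' + 3)) := by
      rw [he, map_add, hacte, AddEquiv.apply_symm_apply]
    have heLayer : toLoc hV e ∈ localLayerPointsOfEmb κ ι W (m' + 1) := by rw [he_toLoc]; exact heL (m' + 1)
    have heL' : e ∈ subfieldPoints (genFibΩ 2 M) (ℚ_[2]⟮zeta 2 (m' + 1 + 2) + (zeta 2 (m' + 1 + 2))⁻¹ - 2⟯).toSubfield
        (PlusTower.coeffs_mem_adjoin M _) := by
      have h := (mem_localLayerPointsOfEmb_two_iff_mem_subfieldPoints_adjoin_v hV ι hκ (m' + 1) (toLoc hV e)).mp heLayer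
      rwa [AddEquiv.symm_apply_apply] at h
    have hactL : act (σ (m' + 3)) (c (m' + 3)) ∈ subfieldPoints (genFibΩ 2 M) (layer 2 (m' + 3)).toSubfield coeffs_mem_layer :=
      act_mem_subfieldPoints act (act_zero hV) (act_some hV) _ (hcL (m' + 3))
    have hactk : act (σ (m' + 3)) (c (m' + 3)) ∈ kernel (Valued.v (R := PadicAlgCl 2)) (genFibΩ 2 M) :=
      act_mem_kernel act (act_zero hV) (act_some hV) _ (hck (m' + 3))
    have hek : e ∈ kernel (Valued.v (R := PadicAlgCl 2)) (genFibΩ 2 M) :=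
      (kernel (Valued.v (R := PadicAlgCl 2)) (genFibΩ 2 M)).add_mem (hck (m' + 3)) hactk
    have heℓ : ptLogΩ 2 M e - (zeta 2 (m' + 1 + 2) + (zeta 2 (m' + 1 + 2))⁻¹ - 2) ∈
        ℚ_[2]⟮zeta 2 (m' + 1 + 1) + (zeta 2 (m' + 1 + 1))⁻¹ - 2⟯ := by
      haveI := isIntegral_curveK 2 (LayerField 2 (m' + 3)) M
      rw [he, ptLogΩ_add (m := m' + 3) (hcL (m' + 3)) hactL (hck (m' + 3)) hactk,
        ptLogΩ_act act (act_zero hV) (act_some hV) _ (norm_zCoord_lt_one_of_mem_kernel (hck (m' + 3))), hcΛ (m' + 3)]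
      exact sprungEll_add_smul_sub_v_mem_adjoin_v hx0 m' hσ3
    -- `N₁ • Q` lies in the image of `E₁`
    have hQlayer : (toLoc hV).symm Q ∈ subfieldPoints (genFibΩ 2 M) (layer 2 (m' + 3)).toSubfield coeffs_mem_layer := by
      obtain ⟨τ₀, -, hτ₀⟩ := exists_inverter_mem_localLayerSubgroupOfEmb_two ι hκ (m' + 1)
      exact (forall_smul_eq_iff_mem_subfieldPoints hV (m' + 3) Q).mp
        ((mem_localLayerPointsOfEmb_two_iff_stab W ι hκ hτ₀ Q).mp hQ).1
    have hNQk : (toLoc hV).symm (N₁ • Q) ∈ kernel (Valued.v (R := PadicAlgCl 2)) (genFibΩ 2 M) := by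
      have h : N₁ • (toLoc hV).symm Q ∈ kernel (Valued.v (R := PadicAlgCl 2)) (genFibΩ 2 M) :=
        card_smul_mem_kernel_of_mem_subfieldPoints M hQlayer
      rw [← map_nsmul] at h
      exact @h
    have hNQn : toLoc hV ((toLoc hV).symm (N₁ • Q)) ∈ localLayerPointsOfEmb κ ι W (m' + 1) := by
      rw [AddEquiv.apply_symm_apply]; exact AddSubgroup.nsmul_mem _ hQ N₁
    -- (GEN) for `N₁ • Q` with generator `e` (file V)
    obtain ⟨B, hB, P', hP', R, hR, hEq⟩ :=
      plusGen_kernel_two_sprung hV ι hκ hxb hi0 hj0 hij hlog (n := m' + 1) (by omega) htors heL' hek heℓ hNQk hNQn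
    rw [AddEquiv.apply_symm_apply] at hEq
    rw [he_toLoc] at hB
    -- generator change `e ↦ d = N₁•e − 2•y_1` (odd `N₁`), then odd saturation
    have hc1 : toLoc hV (c 1) ∈ localLayerPointsOfEmb κ ι W (m' + 1 - 1) :=
      localLayerPointsOfEmb_mono κ ι W (Nat.zero_le _) hy1L0
    have hedc : N₁ • (toLoc hV (c (m' + 3)) + σ (m' + 3) • toLoc hV (c (m' + 3))) =
        (N₁ • (toLoc hV (c (m' + 1 + 2)) + σ (m' + 1 + 2) • toLoc hV (c (m' + 1 + 2))) - 2 • toLoc hV (c 1)) +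
          2 • toLoc hV (c 1) := by
      rw [sub_add_cancel]
    have hgen := plusGen_of_plusGen_generator_change_odd (G := absoluteGaloisGroup ℚ_[2])
      (H := localLayerPointsOfEmb κ ι W (m' + 1)) (H' := localLayerPointsOfEmb κ ι W (m' + 1 - 1))
      (fun g _ hx ↦ Sprung2012.smul_mem_localLayerPointsOfEmb κ ι W _ g hx) hN₁odd hedc hc1 hQ
      ⟨B, hB, P', hP', R, hR, hEq⟩
    exact hgen
  · -- (NONDIV) `cneg ∉ 2E(ℚ₂)`
    intro b hb
    exact sprung_one_ne_two_nsmul hV hx0 hN₁odd hcL hck hcΛ ((mem_localLayerPointsOfEmb_zero_iff κ ι W b).mp hb)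


end Summit.BirchSwinnertonDyer.BirchSwinnertonDyer.Theorems.SSHondaTwo

end
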